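import Summits.ValiantsHypothesis.ValiantsHypothesis.Theorems.DefinabilityGapPivotLive
import HarnessLib

/-!
# DefinabilityGap — pivot certificates: liveness with a few CROWDED rows

Route `route-ValiantsHypothesis-DefinabilityGap`, residual crux `KIPlantedHitting` (item 23547),
rung `R_K1.1`, ROAD P.  `DefinabilityGapPivotLive.liveAt_of_halfDegree` asks every row of the
minor of `S_c` to have fewer than `m/2` killed cells.  The paper analysis of the remaining
existence step (NODE-v7 §H, N1) shows this is too much to ask of a row assignment: a curve may
carry a BOUNDED number of «crowded» rows (rows made of high-multiplicity cells, at most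
`O(N/m²) = O(1)` of them by `Σ_{x ∈ c} (μ_x − 1) ≤ 2N`), which can lose more than half of their
cells.  This file proves the refinement the analysis needs: rows with `≥ m/2` killed cells are
allowed, provided each of them keeps at least as many free cells as there are such rows
(`liveAt_of_fewBadRows`; Hall's theorem — large column sets still reach every good row, and miss
a bad row only when they avoid all its free cells).  With no bad row it is
`liveAt_of_halfDegree`.  Certificate-level corollary: `kiPivotCertificate_of_fewBadRows`.
-/

noncomputable section

open Finset
open Literature.Computability.AlgebraicComplexity Literature.Computability.MetaComplexity
open Summit.ValiantsHypothesis.ValiantsHypothesis.Theorems.DefinabilityGapAffineRung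
open Summit.ValiantsHypothesis.ValiantsHypothesis.Theorems.DefinabilityGapSupportRung
open Summit.ValiantsHypothesis.ValiantsHypothesis.Theorems.DefinabilityGapPivotCertificate
open Summit.ValiantsHypothesis.ValiantsHypothesis.Theorems.DefinabilityGapPivotLive

namespace Summit.ValiantsHypothesis.ValiantsHypothesis.Theorems.DefinabilityGapPivotLiveWeak

variable {m : ℕ}

/-- The BAD (crowded) rows of the minor of `S_c` (row `r`, column `s₀` deleted): rows `i ≠ r`
with at least `m/2` killed cells. [this file] -/
def badRows (W : Finset (Fin (qOf m) × Fin (qOf m))) (c : Fin 3 → Fin (qOf m)) (r s₀ : Fin m) :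
    Finset (Fin m) :=
  univ.filter fun i => i ≠ r ∧ m ≤ 2 * (deadCols W c s₀ i).card

/-- Membership in the bad rows. [this file] -/
theorem mem_badRows {W : Finset (Fin (qOf m) × Fin (qOf m))} {c : Fin 3 → Fin (qOf m)}
    {r s₀ i : Fin m} : i ∈ badRows W c r s₀ ↔ i ≠ r ∧ m ≤ 2 * (deadCols W c s₀ i).card := by
  simp [badRows]

/-- **Liveness with few bad rows.** If the pivot cell `(r, s₀)` is not a zero, every column
`j ≠ s₀` has at least `(m−1)/2` free rows `≠ r`, and every BAD row (a row `i ≠ r` with `≥ m/2`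
killed cells off column `s₀`) still has at least `#badRows` free cells off column `s₀`
(`#bad + #killed + 1 ≤ m`), then position `(r, s₀)` is live. [this file] -/
theorem liveAt_of_fewBadRows (W : Finset (Fin (qOf m) × Fin (qOf m))) (c : Fin 3 → Fin (qOf m))
    (r s₀ : Fin m) (hpiv : cellEmb m c (r, s₀) ∉ W)
    (hcol : ∀ j, j ≠ s₀ → m ≤ 2 * (okRows W c r j).card + 1)
    (hbad : ∀ i ∈ badRows W c r s₀,
      (badRows W c r s₀).card + (deadCols W c s₀ i).card + 1 ≤ m) :
    LiveAt m W c (r, s₀) := by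
  classical
  -- Hall's condition for the columns `j ≠ s₀` into the free rows
  have hH : ∀ S : Finset {j : Fin m // j ≠ s₀},
      S.card ≤ (S.biUnion fun j => okRows W c r j.1).card := by
    intro S
    rcases S.eq_empty_or_nonempty with rfl | ⟨j₀, hj₀⟩
    · simp
    -- `|S| ≤ m - 1`
    have hS' : (S.map (Function.Embedding.subtype _)).card ≤ (Finset.univ.erase s₀).card :=
      Finset.card_le_card fun j hj => by
        obtain ⟨j', _, rfl⟩ := Finset.mem_map.mp hj
        exact Finset.mem_erase.mpr ⟨j'.2, Finset.mem_univ _⟩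
    rw [Finset.card_map, Finset.card_erase_of_mem (Finset.mem_univ _), Finset.card_univ,
      Fintype.card_fin] at hS'
    by_cases hS : 2 * S.card + 1 ≤ m
    · have h1 : S.card ≤ (okRows W c r j₀.1).card := by have := hcol j₀.1 j₀.2; omega
      exact h1.trans (Finset.card_le_card fun i hi => Finset.mem_biUnion.mpr ⟨j₀, hj₀, hi⟩)
    · -- a row `i ≠ r` missed by `S` has all its `S`-cells killed: it is bad, with few free cells
      have hmiss : ∀ i, i ≠ r → i ∉ (S.biUnion fun j => okRows W c r j.1) →
          i ∈ badRows W c r s₀ ∧ S.card ≤ (deadCols W c s₀ i).card := by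
        intro i hir hnot
        have hsub : S.map (Function.Embedding.subtype _) ⊆ deadCols W c s₀ i := by
          intro j hj
          obtain ⟨j', hj'S, rfl⟩ := Finset.mem_map.mp hj
          refine mem_deadCols.mpr ⟨j'.2, ?_⟩
          by_contra hW
          exact hnot (Finset.mem_biUnion.mpr ⟨j', hj'S, mem_okRows.mpr ⟨hir, hW⟩⟩)
        have h1 := Finset.card_le_card hsub
        rw [Finset.card_map] at h1
        exact ⟨mem_badRows.mpr ⟨hir, by omega⟩, h1⟩
      by_cases hall : Finset.univ.erase r ⊆ S.biUnion fun j => okRows W c r j.1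
      · refine le_trans ?_ (Finset.card_le_card hall)
        rw [Finset.card_erase_of_mem (Finset.mem_univ _), Finset.card_univ, Fintype.card_fin]
        exact hS'
      · obtain ⟨i, hi, hin⟩ := Finset.not_subset.mp hall
        have hir : i ≠ r := Finset.ne_of_mem_erase hi
        obtain ⟨hib, hSi⟩ := hmiss i hir hin
        have hbi := hbad i hib
        -- every row `≠ r` is reached or bad
        have hcover : Finset.univ.erase r ⊆
            (S.biUnion fun j => okRows W c r j.1) ∪ badRows W c r s₀ := by
          intro i' hi'
          by_cases h' : i' ∈ S.biUnion fun j => okRows W c r j.1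
          · exact Finset.mem_union_left _ h'
          · exact Finset.mem_union_right _ (hmiss i' (Finset.ne_of_mem_erase hi') h').1
        have h2 := (Finset.card_le_card hcover).trans (Finset.card_union_le _ _)
        rw [Finset.card_erase_of_mem (Finset.mem_univ _), Finset.card_univ, Fintype.card_fin]
          at h2
        omega
  obtain ⟨g, hg, hgt⟩ := (Finset.all_card_le_biUnion_card_iff_exists_injective _).mp hH
  -- the transversal: column `s₀ ↦ r`, column `j ≠ s₀ ↦ g j`
  let G : Fin m → Fin m := fun j => if h : j = s₀ then r else g ⟨j, h⟩
  have hGne : ∀ j (h : j ≠ s₀), G j ≠ r := by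
    intro j h
    simp only [G, dif_neg h]
    exact (mem_okRows.mp (hgt ⟨j, h⟩)).1
  have hGinj : Function.Injective G := by
    intro j j' h
    by_cases hj : j = s₀ <;> by_cases hj' : j' = s₀
    · rw [hj, hj']
    · exact absurd (by simpa [G, hj] using h.symm) (hGne j' hj')
    · exact absurd (by simpa [G, hj'] using h) (hGne j hj)
    · have h' : g ⟨j, hj⟩ = g ⟨j', hj'⟩ := by simpa [G, hj, hj'] using h
      exact congrArg Subtype.val (hg h')
  refine ⟨Equiv.ofBijective G (Finite.injective_iff_bijective.mp hGinj), fun j => ?_, ?_⟩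
  · rw [Equiv.ofBijective_apply]
    by_cases hj : j = s₀
    · subst hj
      simpa [G] using hpiv
    · simp only [G, dif_neg hj]
      exact (mem_okRows.mp (hgt ⟨j, hj⟩)).2
  · rw [Equiv.ofBijective_apply]
    simp [G]

/-- `liveAt_of_halfDegree` is the case of no bad row. [this file] -/
theorem badRows_eq_empty_of_halfDegree {W : Finset (Fin (qOf m) × Fin (qOf m))}
    {c : Fin 3 → Fin (qOf m)} {r s₀ : Fin m}
    (hrow : ∀ i, i ≠ r → 2 * (deadCols W c s₀ i).card < m) : badRows W c r s₀ = ∅ := by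
  ext i
  simp only [mem_badRows, Finset.notMem_empty, iff_false, not_and, not_le]
  exact hrow i

/-- **Pivot certificate from distinct pivots, column loads and few bad rows.** [this file] -/
theorem kiPivotCertificate_of_fewBadRows (T : Finset (Fin 3 → Fin (qOf m))) (s₀ : Fin m)
    (r : (Fin 3 → Fin (qOf m)) → Fin m)
    (hinj : ∀ c ∈ T, ∀ c' ∈ T, cellEmb m c (r c, s₀) = cellEmb m c' (r c', s₀) → c = c')
    (hcol : ∀ c ∈ T, ∀ j, j ≠ s₀ → m ≤ 2 * (okRows (pivotZeros m T s₀ r) c (r c) j).card + 1)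
    (hbad : ∀ c ∈ T, ∀ i ∈ badRows (pivotZeros m T s₀ r) c (r c) s₀,
      (badRows (pivotZeros m T s₀ r) c (r c) s₀).card
        + (deadCols (pivotZeros m T s₀ r) c s₀ i).card + 1 ≤ m) :
    KIPivotCertificate m T s₀ r :=
  ⟨hinj, fun c hc => liveAt_of_fewBadRows _ c (r c) s₀ (pivot_not_mem_pivotZeros T s₀ r c)
    (hcol c hc) (hbad c hc)⟩

end Summit.ValiantsHypothesis.ValiantsHypothesis.Theorems.DefinabilityGapPivotLiveWeak
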